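import Literature.Computability.MetaComplexity.ParamUniformPadding
import Literature.Computability.Complexity.PromiseRPAmplification
import Literature.Computability.Complexity.PairPlumbing
import HarnessLib

/-!
# Complexity meta: aggregating over the pad in `pr-coRP` (Hirahara 2021, Lemma 3.6, step 2, generator-free)

Topic `Literature/Computability/MetaComplexity`, sequel of `ParamUniformPadding.lean` (the padded
length `N(ℓ, m)`, the pad length `J(ℓ, m)`, the padded language) in the inline proof of a generator-free
form of Lemma 3.6 of S. Hirahara, ECCC TR21-058 (2021), p. 21. In print, a one-sided-error heuristic
`M'` for the padded language under the uniform distribution is turned into one for the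
parameterized uniform distribution by trying, as pads, all outputs of the pseudorandom generator of
Lemma 3.4: "`M((r, 1^{q(n)}), 1ⁿ) := 1` if and only if `M'(rr', 1^{⟨p(n),q(n)⟩}) = 1` for some string
`r' := G_m(z)` in the image of `G_m`". Here the pad `j ← {0,1}^{J(m)}` stays uniformly random and the
aggregation is a promise problem: for a polynomial-time test `A(u, 1^N)` (the heuristic of the
hypothesis `coNP × {U, T} ⊆ Avg¹P`, which has no false negatives on the padded language),

* `ParamUniform.aggProblem A c` — on instances `(r, 1^m)`: YES if `A(r ++ j, 1^{N(|r|,m)})` is false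
  for EVERY pad `j ∈ {0,1}^{J(|r|,m)}`; NO if it is true for at least a `1/(4 N(|r|,m)^c)` fraction of them;
* `ParamUniform.witness A` — the witness language `⟨(r, 1^m), y⟩ ↦ [A(r ++ (y ↾ J), 1^N) = 0]`
  (`FP` bricks `rF`, `umF`, `jF`, `uF`, `argF`, `testF`; `witness_mem_P`), accepting every coin string
  on YES-instances (`witness_yes`) and rejecting a `≥ 1/(4(|v|²+|v|)^c + 1)` fraction on NO-instances
  (`witness_no`; only the prefix of the coins matters, `N ≤ |v|² + |v|`);
* `ParamUniform.aggProblem_mem_PromiseP` — hence the problem is in `pr-coRP`, so in `pr-P` under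
  `PromiseBPP' ⊆ PromiseP` (`mem_PromiseP_of_weak_coRP`, `PromiseRPAmplification.lean`), the decision
  consequence of Lemma 3.4 that replaces the generator.

Small counting facts used downstream (`uniformProb_mono'`, `uniformProb_congr'`,
`uniformProb_setOf_take`) are proved here as well. The case analysis concluding Lemma 3.6 is in
`ParamUniformHeuristics.lean`.

## References

* S. Hirahara, ECCC TR21-058 (2021), Lemma 3.6 and its proof (p. 21), Lemma 3.4 (p. 20; used as
  `pr-BPP = pr-P`, p. 27) [Hirahara2021].
* O. Goldreich, *On promise problems: a survey*, LNCS 3895 (2006), §6.2 (promise-`coRP`)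
  [GoldreichPromise2006].
* S. Arora, B. Barak, *Computational Complexity: A Modern Approach*, CUP 2009, §1.3 [AroraBarakCC2009].
-/

noncomputable section

namespace Literature.Computability.MetaComplexity

open _root_.Computability Polynomial Complexity Complexity.Classes Complexity.Nondeterministic Complexity.Brick
  Complexity.Plumb Complexity.OracleCompose Complexity.HashBricks Complexity.LenCmp

namespace ParamUniform

/-! ### Small counting facts -/

/-- `cnt` is monotone in the event. [folklore] -/
theorem cnt_mono' {m : ℕ} {E E' : Set (List Bool)} (h : ∀ y : List Bool, y.length = m → y ∈ E → y ∈ E') :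
    cnt m E ≤ cnt m E' := by
  classical
  unfold cnt
  exact Finset.card_le_card (fun r hr => by
    simp only [Finset.mem_filter, Finset.mem_univ, true_and] at hr ⊢
    exact h r.toList r.toList_length hr)

/-- `uniformProb` is monotone in the event (on strings of the right length). [folklore] -/
theorem uniformProb_mono' {m : ℕ} {E E' : Set (List Bool)} (h : ∀ y : List Bool, y.length = m → y ∈ E → y ∈ E') :
    uniformProb m E ≤ uniformProb m E' := by
  rw [uniformProb_eq_cnt_div, uniformProb_eq_cnt_div]
  exact div_le_div_of_nonneg_right (by exact_mod_cast cnt_mono' h) (by positivity)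

/-- `uniformProb` only depends on the strings of length `m` in the event. [folklore] -/
theorem uniformProb_congr' {m : ℕ} {E E' : Set (List Bool)} (h : ∀ y : List Bool, y.length = m → (y ∈ E ↔ y ∈ E')) :
    uniformProb m E = uniformProb m E' := by
  rw [uniformProb_eq_cnt_div, uniformProb_eq_cnt_div, cnt_congr h]

/-- **Only a prefix matters**: the probability over `y ∈ {0,1}^{J+d}` of an event of `y ↾ J` is the
probability over `{0,1}^J` (product rule with the sure event on the suffix). [folklore] -/
theorem uniformProb_setOf_take (J d : ℕ) (S : Set (List Bool)) :
    uniformProb (J + d) {y | y.take J ∈ S} = uniformProb J S := by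
  have hcnt : cnt (J + d) {y | y.take J ∈ S} = cnt J S * 2 ^ d := by
    rw [← cnt_univ d, ← cnt_take_drop J d S Set.univ]
    exact cnt_congr fun y _ => by simp
  rw [uniformProb_eq_cnt_div, uniformProb_eq_cnt_div, hcnt, pow_add]
  push_cast
  rw [mul_div_mul_right _ _ (by positivity)]

/-! ### The aggregation promise problem and its `pr-coRP` witness -/

section Witness

variable (A : List Bool → ℕ → Bool) (c : ℕ)

/-- **The aggregation promise problem** over instances `(r, 1^m)`, `|r| = ℓ(m)`, for a test
`A(u, 1^N)` on padded strings `u = r ++ j ∈ {0,1}^{N(|r|, m)}`: YES if `A` is false on EVERY pad `j`, NO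
if `A` is true on at least a `1/(4 N(|r|, m)^c)` fraction of the pads (the substitute, by aggregation
over a uniformly random pad, for Hirahara's "`M((r, 1^q), 1ⁿ) := 1` iff `M'(r r') = 1` for some
`r'` in the image of the pseudorandom generator"). [cite: Hirahara2021, Lemma 3.6 (proof: the algorithm M)] -/
def aggProblem : PromiseProblem where
  yes := {v | ∃ (r : List Bool) (m : ℕ), v = paramEnc (r, m) ∧
    ∀ j : List Bool, j.length = junkLen r.length m → A (r ++ j) (padLen r.length m) = false}
  no := {v | ∃ (r : List Bool) (m : ℕ), v = paramEnc (r, m) ∧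
    1 / (4 * (padLen r.length m : ℝ) ^ c) ≤ uniformProb (junkLen r.length m) {j | A (r ++ j) (padLen r.length m) = true}}

/-- The sample `r` of a witness input `⟨(r, 1^m), y⟩`. [folklore] -/
def rF : List Bool → List Bool := fstF ∘ fstF

/-- The parameter part `1^m` of a witness input `⟨(r, 1^m), y⟩`. [folklore] -/
def umF : List Bool → List Bool := sndF ∘ fstF

/-- The pad `j = y ↾ J(|r|, m)` cut out of the coins `y` of a witness input `⟨(r, 1^m), y⟩`. [folklore] -/
def jF : List Bool → List Bool := takeFn ∘ fanoutFn (junkLenU ∘ fanoutFn rF umF) sndF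

/-- The padded string `u = r ++ j`. [folklore] -/
def uF : List Bool → List Bool := concatFn ∘ fanoutFn rF jF

/-- The argument `⟨u, 1^{N(|r|, m)}⟩` handed to the test. [folklore] -/
def argF : List Bool → List Bool := fanoutFn uF (padLenU ∘ fanoutFn rF umF)

/-- The test `A` as a string function on `⟨u, 1^N⟩` (second component read by its length). [folklore] -/
def runA : List Bool → List Bool := fun w => encodeBool (A (boolUnpair w).1 (boolUnpair w).2.length)

/-- **The witness test** `⟨(r, 1^m), y⟩ ↦ [A(r ++ (y ↾ J), 1^N)]`, `N = N(|r|, m)`, `J = J(|r|, m)`.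
[cite: Hirahara2021, Lemma 3.6 (proof)] -/
def testF : List Bool → List Bool := runA A ∘ argF

/-- **The witness language** of the `pr-coRP` algorithm: accept `⟨(r, 1^m), y⟩` iff the test is
false on the pad cut out of the coins. [cite: Hirahara2021, Lemma 3.6 (proof)] -/
def witness : Language Bool := {w | testF A w = [false]}

variable {A}

/-- Value of the test on a well-formed input. [folklore] -/
theorem testF_boolPair (r : List Bool) (m : ℕ) (y : List Bool) :
    testF A (boolPair (paramEnc (r, m)) y) =
      encodeBool (A (r ++ y.take (junkLen r.length m)) (padLen r.length m)) := by
  simp only [testF, runA, argF, uF, jF, rF, umF, Function.comp_apply, fanoutFn_apply, paramEnc, fstF_boolPair,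
    sndF_boolPair, takeFn_boolPair, concatFn_boolPair, boolUnpair_boolPair, junkLenU_boolPair, padLenU_boolPair,
    length_unaryEncodeNat, length_ones]

/-- Membership of a well-formed input in the witness language. [folklore] -/
theorem boolPair_mem_witness_iff (r : List Bool) (m : ℕ) (y : List Bool) :
    boolPair (paramEnc (r, m)) y ∈ witness A ↔
      A (r ++ y.take (junkLen r.length m)) (padLen r.length m) = false := by
  change testF A (boolPair (paramEnc (r, m)) y) = [false] ↔ _
  rw [testF_boolPair]
  cases A (r ++ y.take (junkLen r.length m)) (padLen r.length m) <;> simp [encodeBool]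

/-- The test is polynomial time (the bricks, then the machine of `A` behind the unary-argument
normaliser, `mem_FP_of_unaryArg`). [cite: AroraBarakCC2009, §1.3] -/
theorem testF_mem_FP (hA : PolyTimeComputable paramEnc encodeBool (Function.uncurry A)) : testF A ∈ FP := by
  have hrm : fanoutFn rF umF ∈ FP :=
    fanoutFn_mem_FP (comp_mem_FP fstF_mem_FP fstF_mem_FP) (comp_mem_FP sndF_mem_FP fstF_mem_FP)
  have hj : jF ∈ FP := comp_mem_FP takeFn_mem_FP (fanoutFn_mem_FP (comp_mem_FP junkLenU_mem_FP hrm) sndF_mem_FP)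
  have hu : uF ∈ FP := comp_mem_FP concatFn_mem_FP (fanoutFn_mem_FP (comp_mem_FP fstF_mem_FP fstF_mem_FP) hj)
  have harg : argF ∈ FP := fanoutFn_mem_FP hu (comp_mem_FP padLenU_mem_FP hrm)
  have hrun : runA A ∈ FP := mem_FP_of_unaryArg hA
  exact comp_mem_FP hrun harg

/-- **The witness language is in `P`.** [cite: AroraBarakCC2009, §1.3] -/
theorem witness_mem_P (hA : PolyTimeComputable paramEnc encodeBool (Function.uncurry A)) : witness A ∈ Classes.P :=
  setOf_apply_eq_apply_mem_P (testF_mem_FP hA) (const_mem_FP [false])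

/-- The padded length is at most `|v|² + |v|` for the instance `v = (r, 1^m)`
(`|v| = 2|r| + 2 + m ≥ |r| + m + 1`). [folklore] -/
theorem padLen_le_sq (r : List Bool) (m : ℕ) :
    padLen r.length m ≤ (paramEnc (r, m)).length * (paramEnc (r, m)).length + (paramEnc (r, m)).length := by
  have hv : (paramEnc (r, m)).length = 2 * r.length + 2 + m := by
    simp [paramEnc, length_boolPair]
  have hs : sLen r.length m ≤ (paramEnc (r, m)).length := by rw [hv]; unfold sLen; omega
  unfold padLen
  exact Nat.add_le_add (Nat.mul_le_mul hs hs) (by rw [hv]; omega)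

/-- **Yes side**: on a yes-instance every coin string of length `|v|² + |v|` (`≥ J(m)`) is accepted
by the witness. [cite: Hirahara2021, Lemma 3.6 (proof: "M does not err")] -/
theorem witness_yes {v : List Bool} (hv : v ∈ (aggProblem A c).yes) (y : List Bool)
    (hy : y.length = (X * X + X : Polynomial ℕ).eval v.length) : boolPair v y ∈ witness A := by
  obtain ⟨r, m, rfl, hall⟩ := hv
  rw [boolPair_mem_witness_iff]
  refine hall _ (List.length_take_of_le ?_)
  have h1 := padLen_le_sq r m
  have h2 : junkLen r.length m ≤ padLen r.length m := Nat.sub_le _ _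
  simp only [eval_add, eval_mul, eval_X] at hy
  omega

/-- **No side**: on a no-instance the witness rejects at least a `1/(4(|v|²+|v|)^c + 1)` fraction
of the coin strings of length `|v|² + |v|` (only the prefix of length `J(m)` matters,
`uniformProb_setOf_take`; `N(m) ≤ |v|² + |v|`). [cite: Hirahara2021, Lemma 3.6 (proof)] -/
theorem witness_no {v : List Bool} (hv : v ∈ (aggProblem A c).no) :
    1 / ((((4 * (X * X + X) ^ c : Polynomial ℕ).eval v.length : ℕ) : ℝ) + 1) ≤
      uniformProb ((X * X + X : Polynomial ℕ).eval v.length) {y | boolPair v y ∉ witness A} := by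
  obtain ⟨r, m, rfl, hprob⟩ := hv
  set v := paramEnc (r, m) with hvdef
  set N := padLen r.length m with hNdef
  set J := junkLen r.length m with hJdef
  have hN : N ≤ v.length * v.length + v.length := padLen_le_sq r m
  have hJ : J ≤ v.length * v.length + v.length := (Nat.sub_le _ _).trans hN
  obtain ⟨d, hd⟩ := Nat.exists_eq_add_of_le hJ
  -- the rejected coin strings are those whose prefix of length `J` makes the test true
  have hset : uniformProb ((X * X + X : Polynomial ℕ).eval v.length) {y | boolPair v y ∉ witness A} =
      uniformProb J {j | A (r ++ j) N = true} := by
    rw [show (X * X + X : Polynomial ℕ).eval v.length = J + d by simp [hd],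
      ← uniformProb_setOf_take J d {j | A (r ++ j) N = true}]
    refine uniformProb_congr' fun y _ => ?_
    simp only [Set.mem_setOf_eq, hvdef, boolPair_mem_witness_iff, Bool.not_eq_false, hNdef, hJdef]
  rw [hset]
  refine le_trans ?_ hprob
  -- `4 N^c ≤ 4 (|v|² + |v|)^c + 1`
  have hNpos : (0 : ℝ) < 4 * (N : ℝ) ^ c := by
    have : 1 ≤ N := one_le_padLen _ _
    positivity
  refine one_div_le_one_div_of_le hNpos ?_
  have hle : ((N : ℕ) : ℝ) ≤ ((v.length * v.length + v.length : ℕ) : ℝ) := by exact_mod_cast hN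
  have hpow : (N : ℝ) ^ c ≤ ((v.length * v.length + v.length : ℕ) : ℝ) ^ c :=
    pow_le_pow_left₀ (by positivity) hle c
  simp only [eval_mul, eval_ofNat, eval_pow, eval_add, eval_X]
  push_cast at hpow ⊢
  nlinarith

/-- **The aggregation problem is in `pr-P` under `pr-BPP = pr-P`** (it is in `pr-coRP` by the
witness: `mem_PromiseP_of_weak_coRP`). [cite: Hirahara2021, Lemma 3.6 (proof), Lemma 3.4 (pr-BPP = pr-P)] -/
theorem aggProblem_mem_PromiseP (hD : PromiseBPP' ⊆ PromiseP)
    (hA : PolyTimeComputable paramEnc encodeBool (Function.uncurry A)) : aggProblem A c ∈ PromiseP :=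
  mem_PromiseP_of_weak_coRP hD (witness_mem_P hA) (X * X + X) (4 * (X * X + X) ^ c)
    (fun _ hv y hy => witness_yes c hv y hy) (fun _ hv => witness_no c hv)

end Witness

end ParamUniform

end Literature.Computability.MetaComplexity
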